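import Literature.Computability.QuantumComplexity.HadamardGadget
import Literature.Barriers.QuantumAdvantage.UncorrectedNoiseIQP
import HarnessLib

/-!
# The Hadamard gadget, II: the IQP circuit of the gadget and its amplitudes

Topic `Literature/Computability/QuantumComplexity`; sequel of `HadamardGadget.lean` towards the
discharge of `PostBQPWith_subset_PostIQPWith` (`PostBQPToPostIQP.lean`; Bremner–Jozsa–Shepherd
2011, proof of Thm. 1, arXiv:1005.1407 p. 7). There the gadget rewriting of an oracle-free
Clifford+`T` gate list was shown to satisfy the path-sum identity `HGadget.pathSum_final`. Here:

* the emitted diagonal operations are **realised as an IQP circuit** over the tree's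
  `iqpDiag = {Z, CZ, T}` (`HGadget.realize`; `circPhase_realize`: its phase function is
  `phaseOf ops`), possibly after a **relabelling** of the path variables (`DOp.map`,
  `phaseOf_map`) — the SWAPs of BJS's gadgets "commuted out to the end of the lines";
* the gate list is **sandwiched** between two layers of Hadamard gates (`HGadget.sandwich`,
  `gmat_sandwich : U = H^{⊗N} U_C H^{⊗N}` through `gmat_hLayerGates : U_{H-layer} = H^{⊗N}`;
  BJS: "we add in extra `H` gates to ensure that every line begins and ends with an `H` gate",
  so that every original `H` is intermediate and the added layers are the `H^{⊗M}` of the IQP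
  circuit `H^{⊗M} D H^{⊗M}`);
* the **amplitude identity** is proved for an arbitrary layout of the lines in the IQP register
  (`HGadget.Layout`: positions `fst a` of the first and `lst a` of the last variables; `place`;
  the constrained path sums `csum` and their invariance under relabelling `csum_map`,
  `csum_map_ops`): `iqpAmplitude_place` expresses
  `⟨y placed on lst| H^{⊗M} D H^{⊗M} |x placed on fst⟩` as `2^{-M} Σ_{x' y'} χ_y(y') χ_x(x')
  csum(x', y')`, `iqpAmplitude_place_eq(_flip)` resums the characters into Hadamard layers, and
  **`iqpAmplitude_gadget`** concludes, for the operations `gadgetOps C i ρ` of the sandwich of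
  `C` (with a `Z` on the last variable of line `i`, the polarity flip between the tree's
  `PostBQP`, post-selecting on `1`, and BJS's post-selection on `0…0`) relabelled along any
  bijection `e` of the register:
  `⟨y on lst| H D H |x on fst⟩ = 2^{-M} (√2)^D 2^N ⟨y[i ↦ ¬y_i]| U_C |x⟩`, `D = freshCount C`,
  i.e. `|⟨y on lst|H D H|x on fst⟩|² = 2^{-D} |⟨y[i ↦ ¬y_i]|U_C|x⟩|²` — BJS's IQP circuit "with the
  same output conditional probabilities", in the tree's matrix semantics.

The register layout demanded by `PostIQPFamily`, the output distribution, post-selection and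
the uniformity of the resulting family are treated in the sequel file.

## References

* M. J. Bremner, R. Jozsa, D. J. Shepherd, *Classical simulation of commuting quantum
  computations implies collapse of the polynomial hierarchy*, Proc. R. Soc. A 467 (2011)
  459–472, arXiv:1005.1407: §2.3, Thm. 1 (proof, Fig. 1), p. 7.
* M. J. Bremner, A. Montanaro, D. J. Shepherd, *Achieving quantum supremacy with sparse and noisy
  commuting quantum computations*, Quantum 1 (2017) 8, §3.1 (amplitudes of `H D H` as character
  sums; the tree's `iqpAmplitude_eq`).
* M. A. Nielsen, I. L. Chuang, *Quantum Computation and Quantum Information*, CUP 2010, §1.4.4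
  eq. (1.50) (`H^{⊗n}`).
-/

noncomputable section

namespace Literature.Computability.QuantumComplexity

open _root_.Computability Complexity Cryptography Matrix
open Literature.Barriers.QuantumAdvantage
open Literature.Probability.RandomGraphs.LowDegree (sgn walsh sgn_true sgn_false)

namespace HGadget

variable {N M : ℕ}

/-! ### Relabelling the path variables -/

/-- Relabelling the variables of a diagonal operation along `ρ : ℕ → ℕ`. [folklore] -/
def DOp.map (ρ : ℕ → ℕ) : DOp → DOp
  | .Z v => .Z (ρ v)
  | .T v => .T (ρ v)
  | .CZ v w => .CZ (ρ v) (ρ w)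

/-- The phase of a relabelled operation is the phase at the pulled-back valuation. [folklore] -/
theorem DOp.phase_map (ρ : ℕ → ℕ) (U : ℕ → Bool) (op : DOp) :
    (op.map ρ).phase U = op.phase (U ∘ ρ) := by
  cases op <;> rfl

/-- The phase of a relabelled list is the phase at the pulled-back valuation. [folklore] -/
theorem phaseOf_map (ρ : ℕ → ℕ) (U : ℕ → Bool) (ops : List DOp) :
    phaseOf (ops.map (DOp.map ρ)) U = phaseOf ops (U ∘ ρ) := by
  induction ops with
  | nil => simp
  | cons op ops ih =>
    simp only [phaseOf, List.map_cons, List.prod_cons] at ih ⊢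
    rw [DOp.phase_map, ih]

/-- A relabelling that is a bijection below the bounds maps operations below `n` to operations
below `n'`. [folklore] -/
theorem DOp.Below.map {n n' : ℕ} {ρ : ℕ → ℕ} (hρ : ∀ v, v < n → ρ v < n')
    (hinj : ∀ v w, v < n → w < n → ρ v = ρ w → v = w) :
    ∀ {op : DOp}, op.Below n → (op.map ρ).Below n'
  | .Z _, hv => hρ _ hv
  | .T _, hv => hρ _ hv
  | .CZ v w, hv => ⟨hρ _ hv.1, hρ _ hv.2.1, fun h => hv.2.2 (hinj v w hv.1 hv.2.1 h)⟩

/-! ### Realising the operations as an IQP circuit over `{Z, CZ, T}` -/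

/-- One abstract operation as (a list of at most one) placed gate(s) of the IQP gate set on `M`
wires; operations with variables out of range are dropped (junk case, excluded by
well-formedness). [cite: BremnerJozsaShepherdPRSA2011, Thm. 1 (proof)] -/
def realizeOp (M : ℕ) : DOp → List (QGate iqpDiag M)
  | .Z v => if h : v < M then [QGate.gate IQPOp.Z (wireEmb ⟨v, h⟩)] else []
  | .T v => if h : v < M then [QGate.gate IQPOp.T (wireEmb ⟨v, h⟩)] else []
  | .CZ v w =>
      if h : v < M ∧ w < M ∧ v ≠ w then
        [QGate.gate IQPOp.CZ (pairEmb ⟨v, h.1⟩ ⟨w, h.2.1⟩ (fun e => h.2.2 (congrArg Fin.val e)))]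
      else []

/-- **The diagonal part of the gadget's IQP circuit**: the emitted operations placed on `M`
wires, in order. [cite: BremnerJozsaShepherdPRSA2011, Thm. 1 (proof)] -/
def realize (M : ℕ) (ops : List DOp) : QCircuit iqpDiag M := ⟨ops.flatMap (realizeOp M)⟩

/-- The phase of a realised in-range operation is its abstract phase. [folklore] -/
theorem prod_gatePhase_realizeOp {op : DOp} (hop : op.Below M) (u : QReg M) :
    ((realizeOp M op).map fun g => gatePhase g u).prod = op.phase (uAt u) := by
  cases op with
  | Z v =>
    have hv : v < M := hop
    simp only [realizeOp, dif_pos hv, List.map_cons, List.map_nil, List.prod_cons, List.prod_nil,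
      mul_one, gatePhase_Z, wire0, DOp.phase, uAt_of_lt _ hv, sgnC]
    rfl
  | T v =>
    have hv : v < M := hop
    simp only [realizeOp, dif_pos hv, List.map_cons, List.map_nil, List.prod_cons, List.prod_nil,
      mul_one, gatePhase_T, wire0, DOp.phase, uAt_of_lt _ hv]
    rfl
  | CZ v w =>
    have h : v < M ∧ w < M ∧ v ≠ w := hop
    simp only [realizeOp, dif_pos h, List.map_cons, List.map_nil, List.prod_cons, List.prod_nil,
      mul_one, gatePhase_CZ, wire0, wire1, DOp.phase, uAt_of_lt _ h.1, uAt_of_lt _ h.2.1]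
    rfl

/-- **The phase function of the realised circuit is `phaseOf ops`** (for operations in range).
[cite: BremnerJozsaShepherdPRSA2011, Thm. 1 (proof)] -/
theorem circPhase_realize {ops : List DOp} (hops : ∀ op ∈ ops, op.Below M) (u : QReg M) :
    circPhase (realize M ops) u = phaseOf ops (uAt u) := by
  induction ops with
  | nil => simp [circPhase, realize, phaseOf]
  | cons op ops ih =>
    have h1 : op.Below M := hops op (by simp)
    have h2 : ∀ op' ∈ ops, op'.Below M := fun op' hop' => hops op' (by simp [hop'])
    have ih' := ih h2
    simp only [circPhase, realize, List.flatMap_cons, List.map_append, List.prod_append,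
      phaseOf, List.map_cons, List.prod_cons] at ih' ⊢
    rw [prod_gatePhase_realizeOp h1, ih']

/-- Every gate of the realised circuit is a gate symbol (no oracle gates). [folklore] -/
theorem realize_isOracleFree (ops : List DOp) : (realize M ops).IsOracleFree := by
  intro g hg
  simp only [realize, List.mem_flatMap] at hg
  obtain ⟨op, -, hg⟩ := hg
  cases op with
  | Z v =>
    by_cases hv : v < M
    · simp only [realizeOp, dif_pos hv, List.mem_singleton] at hg; subst hg; trivial
    · simp [realizeOp, hv] at hg
  | T v =>
    by_cases hv : v < M
    · simp only [realizeOp, dif_pos hv, List.mem_singleton] at hg; subst hg; trivial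
    · simp [realizeOp, hv] at hg
  | CZ v w =>
    by_cases h : v < M ∧ w < M ∧ v ≠ w
    · simp only [realizeOp, dif_pos h, List.mem_singleton] at hg; subst hg; trivial
    · simp [realizeOp, h] at hg

/-! ### A layer of Hadamard gates on every wire is `H^{⊗N}` -/

/-- One Hadamard gate on every wire, in wire order. (BJS 2011, §2.3: "each qubit line begins and
ends with a Hadamard gate".) [cite: BremnerJozsaShepherdPRSA2011, §2.3] -/
def hLayerGates (N : ℕ) : List (QGate cliffordT N) := (List.finRange N).map hOn

/-- The gates of a Hadamard layer are oracle-free. [folklore] -/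
theorem isOracleFree_of_mem_hLayerGates {g : QGate cliffordT N} (hg : g ∈ hLayerGates N) :
    g.IsOracleFree := by
  unfold hLayerGates at hg
  obtain ⟨a, -, rfl⟩ := List.mem_map.1 hg
  trivial

/-- **Column action of a one-qubit gate**: `(P U_i)(x, y) = Σ_b P(x, y[i ↦ b]) U(b, y_i)`.
(Nielsen–Chuang 2010, §4.2.) [folklore] -/
theorem mul_placeGate_wireEmb_apply (P : Matrix (QReg N) (QReg N) ℂ) (i : Fin N)
    (U : Matrix (QReg 1) (QReg 1) ℂ) (x y : QReg N) :
    (P * placeGate (wireEmb i) U) x y =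
      ∑ b : Bool, P x (Function.update y i b) * U (fun _ => b) (fun _ => y i) := by
  rw [Matrix.mul_apply]
  have key : ∀ y', P x y' * placeGate (wireEmb i) U y' y =
      if (∀ l, l ≠ i → y' l = y l) then P x y' * U (fun _ => y' i) (fun _ => y i) else 0 := by
    intro y'
    rw [placeGate_wireEmb_apply]
    split_ifs <;> simp
  simp_rw [key]
  rw [sum_ite_agreeOff_eq_sum_bool]
  simp

/-- Hadamard gates on the distinct wires `ws`, as a matrix: `∏_{a ∈ ws} H(x_a, y_a)` between
labels agreeing off `ws`, else `0`. (Nielsen–Chuang 2010, §1.4.4.) [cite: NielsenChuang2010, §1.4.4] -/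
theorem gmat_map_hOn_apply (ws : List (Fin N)) (hws : ws.Nodup) (x y : QReg N) :
    gmat (ws.map hOn) x y =
      if (∀ i, i ∉ ws → x i = y i) then
        (ws.map fun a => hGate (fun _ : Fin 1 => x a) (fun _ => y a)).prod else 0 := by
  induction ws generalizing y with
  | nil =>
    simp only [gmat, List.map_nil, QCircuit.toMatrix_nil, Matrix.one_apply, List.not_mem_nil,
      not_false_eq_true, forall_const, List.prod_nil]
    simp [funext_iff]
  | cons a ws ih =>
    have ha : a ∉ ws := (List.nodup_cons.1 hws).1
    have hws' : ws.Nodup := (List.nodup_cons.1 hws).2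
    have hcons : gmat ((a :: ws).map hOn) = gmat (ws.map hOn) * (hOn a).toMatrix 0 := by
      simp [gmat, QCircuit.toMatrix_cons]
    rw [hcons, hOn_toMatrix, mul_placeGate_wireEmb_apply, Fintype.sum_bool, ih hws', ih hws']
    have hP : ∀ b : Bool, (ws.map fun a' => hGate (fun _ : Fin 1 => x a')
        (fun _ => Function.update y a b a')).prod =
          (ws.map fun a' => hGate (fun _ : Fin 1 => x a') (fun _ => y a')).prod := by
      intro b
      refine congrArg List.prod (List.map_congr_left fun a' ha' => ?_)
      rw [Function.update_of_ne (ne_of_mem_of_not_mem ha' ha)]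
    have hcond : ∀ b : Bool, (∀ i, i ∉ ws → x i = Function.update y a b i) ↔
        ((∀ i, i ∉ a :: ws → x i = y i) ∧ x a = b) := by
      intro b
      constructor
      · intro h
        refine ⟨fun i hi => ?_, by simpa using h a ha⟩
        simp only [List.mem_cons, not_or] at hi
        simpa [Function.update_of_ne hi.1] using h i hi.2
      · rintro ⟨h, hxa⟩ i hi
        by_cases hia : i = a
        · subst hia; simpa using hxa
        · rw [Function.update_of_ne hia]
          exact h i (by simp [hia, hi])
    by_cases hc : ∀ i, i ∉ a :: ws → x i = y i
    · rw [if_pos hc, List.map_cons, List.prod_cons]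
      have hyes : ∀ i, i ∉ ws → x i = Function.update y a (x a) i := (hcond (x a)).2 ⟨hc, rfl⟩
      have hno : ¬ (∀ i, i ∉ ws → x i = Function.update y a (!x a) i) := fun h => by
        have := ((hcond (!x a)).1 h).2
        cases hxa : x a <;> rw [hxa] at this <;> exact Bool.noConfusion this
      cases hxa : x a
      · rw [hxa] at hyes hno
        simp only [Bool.not_false] at hno
        rw [if_neg hno, if_pos hyes, hP]
        ring
      · rw [hxa] at hyes hno
        simp only [Bool.not_true] at hno
        rw [if_pos hyes, if_neg hno, hP]
        ring
    · rw [if_neg hc, if_neg (fun h => hc ((hcond true).1 h).1),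
        if_neg (fun h => hc ((hcond false).1 h).1)]
      simp

/-- **A layer of Hadamard gates on every wire is `H^{⊗N}`.** (Nielsen–Chuang 2010, §1.4.4
eq. (1.50); BJS 2011, §2.3.) [cite: NielsenChuang2010, §1.4.4 eq. (1.50)] -/
theorem gmat_hLayerGates (N : ℕ) : gmat (hLayerGates N) = hGateAll N := by
  ext x y
  rw [hLayerGates, gmat_map_hOn_apply _ (List.nodup_finRange N), if_pos (fun i hi => absurd
    (List.mem_finRange i) hi)]
  rw [hGateAll, Matrix.of_apply, neg_one_pow_card_filter_and, ← Fin.prod_univ_def]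
  simp_rw [hGate_apply_eq]
  rw [Finset.prod_mul_distrib, Finset.prod_const, Finset.card_univ, Fintype.card_fin]
  congr 1
  · simp [invSqrt2, one_div]
  · refine Finset.prod_congr rfl fun i _ => ?_
    cases x i <;> cases y i <;> simp [bsgn]

/-! ### The sandwiched gate list -/

/-- The gate list of `C` with a Hadamard gate added at the beginning and at the end of every
line (BJS 2011, proof of Thm. 1: "we add in extra `H` gates to ensure that every line begins and
ends with an `H` gate. This is possible since `H² = I`"). Its gadget rewriting has all original
gates intermediate; the added layers become the `H^{⊗}`-layers of the IQP circuit.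
[cite: BremnerJozsaShepherdPRSA2011, Thm. 1 (proof)] -/
def sandwich (C : QCircuit cliffordT N) : List (QGate cliffordT N) :=
  hLayerGates N ++ C.gates ++ hLayerGates N

/-- The sandwich of an oracle-free circuit is oracle-free. [folklore] -/
theorem sandwich_isOracleFree {C : QCircuit cliffordT N} (hC : C.IsOracleFree) :
    ∀ g ∈ sandwich C, g.IsOracleFree := by
  intro g hg
  simp only [sandwich, List.mem_append] at hg
  rcases hg with (hg | hg) | hg
  · exact isOracleFree_of_mem_hLayerGates hg
  · exact hC g hg
  · exact isOracleFree_of_mem_hLayerGates hg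

/-- Matrices of concatenated gate lists multiply (second list on the left). [folklore] -/
theorem gmat_append (l l' : List (QGate cliffordT N)) : gmat (l ++ l') = gmat l' * gmat l := by
  change (QCircuit.append ⟨l⟩ ⟨l'⟩).toMatrix 0 = _
  rw [QCircuit.toMatrix_append]

/-- **The matrix of the sandwich**: `U_{sandwich C} = H^{⊗N} U_C H^{⊗N}`.
[cite: BremnerJozsaShepherdPRSA2011, Thm. 1 (proof)] -/
theorem gmat_sandwich (C : QCircuit cliffordT N) :
    gmat (sandwich C) = hGateAll N * C.toMatrix 0 * hGateAll N := by
  rw [sandwich, gmat_append, gmat_append, gmat_hLayerGates, ← Matrix.mul_assoc]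

/-! ### Layouts: where the first and the last variables of the lines sit -/

/-- A **layout** of the `N` lines in an IQP register of `M` wires: the positions `fst a` of the
first path variables (the physical input wires of the lines) and `lst a` of the last ones (the
wires carrying the lines' outputs), each family injective. (BJS 2011, proof of Thm. 1: the SWAPs
of the gadgets "commuted out to the end of the lines" are a relabelling of positions.)
[cite: BremnerJozsaShepherdPRSA2011, Thm. 1 (proof)] -/
structure Layout (N M : ℕ) where
  /-- positions of the first variables -/
  fst : Fin N → Fin M
  /-- positions of the last (current) variables -/
  lst : Fin N → Fin M
  /-- distinct lines have distinct first variables -/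
  fst_injective : Function.Injective fst
  /-- distinct lines have distinct last variables -/
  lst_injective : Function.Injective lst

/-- The label of the IQP register with the bits of `v` at the positions `f a` and `0` elsewhere.
[folklore] -/
def place (f : Fin N → Fin M) (v : QReg N) : QReg M := Function.extend f v fun _ => false

/-- `place f v` at a position `f a`. [folklore] -/
theorem place_apply {f : Fin N → Fin M} (hf : Function.Injective f) (v : QReg N) (a : Fin N) :
    place f v (f a) = v a :=
  hf.extend_apply _ _ _

/-- `place f v` off the range of `f`. [folklore] -/
theorem place_apply_of_forall_ne {f : Fin N → Fin M} (v : QReg N) {w : Fin M} (hw : ∀ a, f a ≠ w) :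
    place f v w = false := by
  rw [place, Function.extend_apply' _ _ _ (fun ⟨a, ha⟩ => hw a ha)]

/-- The support of a placed label is the image of the support. [folklore] -/
theorem supp_place {f : Fin N → Fin M} (hf : Function.Injective f) (v : QReg N) :
    supp (place f v) = (supp v).map ⟨f, hf⟩ := by
  ext w
  simp only [supp, Finset.mem_filter, Finset.mem_univ, true_and, Finset.mem_map,
    Function.Embedding.coeFn_mk]
  constructor
  · intro hw
    by_cases h : ∃ a, f a = w
    · obtain ⟨a, rfl⟩ := h
      exact ⟨a, by rwa [place_apply hf] at hw, rfl⟩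
    · rw [place_apply_of_forall_ne v (fun a ha => h ⟨a, ha⟩)] at hw
      exact absurd hw Bool.false_ne_true
  · rintro ⟨a, ha, rfl⟩
    rwa [place_apply hf]

/-- **Walsh characters of placed labels** read the constrained values: if `u (f a) = v' a` for all
`a` then `χ_{supp (place f v)}(u) = χ_{supp v}(v')`. [folklore] -/
theorem walsh_supp_place {f : Fin N → Fin M} (hf : Function.Injective f) (v v' : QReg N) {u : QReg M}
    (h : ∀ a, u (f a) = v' a) : walsh (supp (place f v)) u = walsh (supp v) v' := by
  rw [supp_place hf, walsh, walsh, Finset.prod_map]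
  refine Finset.prod_congr rfl fun a _ => ?_
  simp [h a]

/-- The **constrained path sum** of a weight `Φ` for the layout `L`:
`Σ_{u : u(fst a) = x'_a, u(lst a) = y'_a} Φ(u)`. [cite: BremnerJozsaShepherdPRSA2011, Thm. 1 (proof)] -/
def csum (L : Layout N M) (Φ : QReg M → ℂ) (x' y' : QReg N) : ℂ :=
  ∑ u : QReg M, if (∀ a, u (L.fst a) = x' a) ∧ (∀ a, u (L.lst a) = y' a) then Φ u else 0

/-- Transporting a layout along a relabelling of the register. [folklore] -/
def Layout.map {M' : ℕ} (L : Layout N M) (e : Fin M ≃ Fin M') : Layout N M' where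
  fst := e ∘ L.fst
  lst := e ∘ L.lst
  fst_injective := e.injective.comp L.fst_injective
  lst_injective := e.injective.comp L.lst_injective

/-- **Constrained path sums are invariant under relabelling**: the sum for the transported
layout and the pulled-back weight is the original sum. [folklore] -/
theorem csum_map {M' : ℕ} (L : Layout N M) (e : Fin M ≃ Fin M') (Φ : QReg M → ℂ) (x' y' : QReg N) :
    csum (L.map e) (fun u' => Φ (u' ∘ e)) x' y' = csum L Φ x' y' := by
  unfold csum
  refine Fintype.sum_equiv ((e.arrowCongr (Equiv.refl Bool)).symm) _ _ fun u' => ?_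
  have h1 : (((e.arrowCongr (Equiv.refl Bool)).symm u') : QReg M) = u' ∘ e := by
    funext w; simp [Equiv.arrowCongr]
  simp only [h1, Layout.map, Function.comp_apply]

/-- Inserting the values of `u` on the positions `f a` as a summation variable. [folklore] -/
theorem sum_eq_sum_sum_ite (f : Fin N → Fin M) (G : QReg M → ℂ) :
    (∑ u : QReg M, G u) = ∑ v : QReg N, ∑ u : QReg M, if (∀ a, u (f a) = v a) then G u else 0 := by
  rw [Finset.sum_comm]
  refine Finset.sum_congr rfl fun u _ => ?_
  have h : ∀ v : QReg N, (∀ a, u (f a) = v a) ↔ (fun a => u (f a)) = v := fun v =>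
    ⟨fun h => funext h, fun h a => congrFun h a⟩
  simp_rw [h]
  rw [Finset.sum_ite_eq]
  simp

/-- **The amplitude identity of the gadget (layout-generic form).** If the operations `ops` are
in range, then for the IQP circuit `H^{⊗M} D_{ops} H^{⊗M}`, the input label `x` placed on the
first variables and the output label `y` placed on the last variables,
`⟨place lst y| H^{⊗M} D H^{⊗M} |place fst x⟩ = 2^{-M} Σ_{x', y'} χ_y(y') χ_x(x') csum(x', y')`.
(BJS 2011, proof of Thm. 1, the IQP circuit of the gadget construction; amplitudes of `H D H` as
character sums, Bremner–Montanaro–Shepherd 2017, §3.1.)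
[cite: BremnerJozsaShepherdPRSA2011, Thm. 1 (proof)] -/
theorem iqpAmplitude_place (L : Layout N M) {ops : List DOp} (hops : ∀ op ∈ ops, op.Below M)
    (x y : QReg N) :
    iqpAmplitude (realize M ops) (place L.fst x) (place L.lst y) =
      ((2 : ℂ) ^ M)⁻¹ * ∑ x' : QReg N, ∑ y' : QReg N,
        ((walsh (supp y) y' : ℝ) : ℂ) * ((walsh (supp x) x' : ℝ) : ℂ) *
          csum L (fun u => phaseOf ops (uAt u)) x' y' := by
  rw [iqpAmplitude_eq]
  congr 1
  simp_rw [twistedPhase, circPhase_realize hops]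
  rw [sum_eq_sum_sum_ite L.fst]
  refine Finset.sum_congr rfl fun x' _ => ?_
  rw [sum_eq_sum_sum_ite L.lst]
  refine Finset.sum_congr rfl fun y' _ => ?_
  rw [csum, Finset.mul_sum]
  refine Finset.sum_congr rfl fun u _ => ?_
  by_cases h1 : ∀ a, u (L.fst a) = x' a
  · by_cases h2 : ∀ a, u (L.lst a) = y' a
    · rw [if_pos h2, if_pos h1, if_pos ⟨h1, h2⟩, walsh_supp_place L.lst_injective y y' h2,
        walsh_supp_place L.fst_injective x x' h1]
      ring
    · rw [if_neg h2, if_neg (fun h => h2 h.2), mul_zero]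
  · rw [if_neg h1]
    by_cases h2 : ∀ a, u (L.lst a) = y' a
    · rw [if_pos h2, if_neg (fun h => h1 h.1), mul_zero]
    · rw [if_neg h2, if_neg (fun h => h1 h.1), mul_zero]

/-- `(√2)^N (1/√2)^N = 1`. [folklore] -/
theorem sqrt2_pow_mul_inv_pow (N : ℕ) : (Real.sqrt 2 : ℂ) ^ N * ((Real.sqrt 2 : ℂ)⁻¹) ^ N = 1 := by
  rw [← mul_pow, mul_inv_cancel₀ sqrt2_ne_zero, one_pow]

/-- Walsh characters through `H^{⊗N}`: `χ_{supp a}(b) = (√2)^N ⟨a|H^{⊗N}|b⟩`.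
(Nielsen–Chuang 2010, §1.4.4 eq. (1.50).) [cite: NielsenChuang2010, §1.4.4 eq. (1.50)] -/
theorem walsh_supp_eq_mul_hGateAll (a b : QReg N) :
    ((walsh (supp a) b : ℝ) : ℂ) = (Real.sqrt 2 : ℂ) ^ N * hGateAll N a b := by
  rw [hGateAll_apply_eq, ← mul_assoc, sqrt2_pow_mul_inv_pow, one_mul]

/-- **Resumming the characters into Hadamard layers**: for any matrix `P`,
`Σ_{x', y'} χ_y(y') χ_x(x') P(y', x') = 2^N (H^{⊗N} P H^{⊗N})(y, x)`.
(Nielsen–Chuang 2010, §1.4.4 eq. (1.50).) [cite: NielsenChuang2010, §1.4.4 eq. (1.50)] -/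
theorem sum_walsh_walsh_mul (P : Matrix (QReg N) (QReg N) ℂ) (x y : QReg N) :
    (∑ x' : QReg N, ∑ y' : QReg N,
      ((walsh (supp y) y' : ℝ) : ℂ) * ((walsh (supp x) x' : ℝ) : ℂ) * P y' x') =
      (2 : ℂ) ^ N * (hGateAll N * P * hGateAll N) y x := by
  have h2 : (Real.sqrt 2 : ℂ) ^ N * (Real.sqrt 2 : ℂ) ^ N = (2 : ℂ) ^ N := by
    rw [← mul_pow, ← Complex.ofReal_mul, Real.mul_self_sqrt (by norm_num : (0:ℝ) ≤ 2)]
    norm_num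
  simp only [Matrix.mul_apply]
  rw [Finset.mul_sum]
  refine Finset.sum_congr rfl fun x' _ => ?_
  rw [Finset.sum_mul, Finset.mul_sum]
  refine Finset.sum_congr rfl fun y' _ => ?_
  rw [walsh_supp_eq_mul_hGateAll, walsh_supp_comm x x', walsh_supp_eq_mul_hGateAll, ← h2]
  ring

/-- Flipping the bit `i` of the index of a Walsh character multiplies it by the sign of `i`.
[cite: ODonnell2014, §1.4] -/
theorem walsh_supp_update_not (y y' : QReg N) (i : Fin N) :
    walsh (supp (Function.update y i (!y i))) y' = walsh (supp y) y' * sgn (y' i) := by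
  have hsupp : supp (Function.update y i (!y i)) =
      if y i = true then (supp y).erase i else insert i (supp y) := by
    ext j
    by_cases hji : j = i
    · subst hji; cases h : y j <;> simp [supp, h]
    · cases h : y i <;> simp [supp, hji]
  rw [hsupp, walsh, walsh]
  cases hy : y i
  · have hi : i ∉ supp y := by simp [supp, hy]
    simp only [Bool.false_eq_true, if_false]
    rw [Finset.prod_insert hi, mul_comm]
  · have hi : i ∈ supp y := by simp [supp, hy]
    simp only [if_true]
    rw [← Finset.prod_erase_mul _ _ hi, mul_assoc]
    cases y' i <;> simp

/-- **The amplitude identity, evaluated.** If the constrained path sums of `Φ = phaseOf ops`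
are `csum(x', y') = c · P(y', x')` for a constant `c` and a matrix `P` (for the gadget
rewriting of the sandwich of `C`: `c = (√2)^k`, `P = H^{⊗N} U_C H^{⊗N}`,
`HGadget.pathSum_final` with `gmat_sandwich`), then
`⟨place lst y| H^{⊗M} D H^{⊗M} |place fst x⟩ = 2^{-M} c 2^N (H^{⊗N} P H^{⊗N})(y, x)`
(`= (√2)^{-k} ⟨y|U_C|x⟩` in that case, by `H^{⊗N} H^{⊗N} = 1`).
[cite: BremnerJozsaShepherdPRSA2011, Thm. 1 (proof: "the same output conditional probabilities")] -/
theorem iqpAmplitude_place_eq (L : Layout N M) {ops : List DOp} (hops : ∀ op ∈ ops, op.Below M)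
    (c : ℂ) (P : Matrix (QReg N) (QReg N) ℂ)
    (hcs : ∀ x' y' : QReg N, csum L (fun u => phaseOf ops (uAt u)) x' y' = c * P y' x')
    (x y : QReg N) :
    iqpAmplitude (realize M ops) (place L.fst x) (place L.lst y) =
      ((2 : ℂ) ^ M)⁻¹ * (c * ((2 : ℂ) ^ N * (hGateAll N * P * hGateAll N) y x)) := by
  rw [iqpAmplitude_place L hops]
  rw [← sum_walsh_walsh_mul P x y]
  congr 1
  rw [Finset.mul_sum]
  refine Finset.sum_congr rfl fun x' _ => ?_
  rw [Finset.mul_sum]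
  refine Finset.sum_congr rfl fun y' _ => ?_
  rw [hcs]
  ring

/-- **The amplitude identity with a sign flip on line `i`** (a `Z` on the last variable of line
`i`, flipping the polarity of a post-selected or output wire: BJS post-select on `0…0`, the tree's
`PostBQP` on `1`): if `csum(x', y') = c · (-1)^{y'_i} P(y', x')` then the amplitude at
`place lst y` is that of `P` at the flipped label `y[i ↦ ¬y_i]`.
[cite: BremnerJozsaShepherdPRSA2011, §2.4 and Thm. 1 (proof)] -/
theorem iqpAmplitude_place_eq_flip (L : Layout N M) {ops : List DOp} (hops : ∀ op ∈ ops, op.Below M)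
    (c : ℂ) (P : Matrix (QReg N) (QReg N) ℂ) (i : Fin N)
    (hcs : ∀ x' y' : QReg N,
      csum L (fun u => phaseOf ops (uAt u)) x' y' = c * ((sgn (y' i) : ℝ) : ℂ) * P y' x')
    (x y : QReg N) :
    iqpAmplitude (realize M ops) (place L.fst x) (place L.lst y) =
      ((2 : ℂ) ^ M)⁻¹ * (c * ((2 : ℂ) ^ N *
        (hGateAll N * P * hGateAll N) (Function.update y i (!y i)) x)) := by
  rw [iqpAmplitude_place L hops]
  rw [← sum_walsh_walsh_mul P x (Function.update y i (!y i))]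
  congr 1
  rw [Finset.mul_sum]
  refine Finset.sum_congr rfl fun x' _ => ?_
  rw [Finset.mul_sum]
  refine Finset.sum_congr rfl fun y' _ => ?_
  rw [hcs, walsh_supp_update_not]
  push_cast
  ring

/-! ### From the gadget invariant to constrained path sums -/

variable {D : ℕ}

/-- **The native layout** of a well-formed rewriting state with at most `D` fresh variables, in
the register of `N + D` path variables: line `a` has its first variable at position `a` and its
last variable at position `cur a`. [cite: BremnerJozsaShepherdPRSA2011, Thm. 1 (proof)] -/
def St.layout (s : St N) (hs : s.WF) (hD : s.k ≤ D) : Layout N (N + D) where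
  fst a := ⟨a, by omega⟩
  lst a := ⟨s.cur a, by have := hs.cur_lt a; omega⟩
  fst_injective a b h := Fin.ext (by simpa using congrArg Fin.val h)
  lst_injective a b h := hs.cur_inj (by simpa using congrArg Fin.val h)

/-- The constrained path sum of the native layout is the sum `psum` of the invariant. [folklore] -/
theorem csum_layout_eq_psum (s : St N) (hs : s.WF) (hD : s.k ≤ D) (x' y' : QReg N) :
    csum (s.layout hs hD) (fun u => phaseOf s.ops (uAt u)) x' y' = psum D s x' y' := by
  unfold csum psum Cns
  refine Finset.sum_congr rfl fun u _ => ?_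
  have h1 : ∀ a : Fin N, uAt u a = u ((s.layout hs hD).fst a) := fun a =>
    uAt_of_lt u (by omega)
  have h2 : ∀ a : Fin N, uAt u (s.cur a) = u ((s.layout hs hD).lst a) := fun a =>
    uAt_of_lt u (by have := hs.cur_lt a; omega)
  simp only [h1, h2]

/-- **The invariant as a constrained path sum**: if `(P, s)` satisfies the gadget invariant with
exactly `D` fresh variables then `csum(x', y') = (√2)^D P(y', x')` for the native layout.
[cite: BremnerJozsaShepherdPRSA2011, Thm. 1 (proof)] -/
theorem GInv.csum_eq {P : Matrix (QReg N) (QReg N) ℂ} {s : St N} (h : GInv D P s) (hk : s.k = D)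
    (x' y' : QReg N) :
    csum (s.layout h.wf hk.le) (fun u => phaseOf s.ops (uAt u)) x' y' =
      (Real.sqrt 2 : ℂ) ^ D * P y' x' := by
  have h2 : (2 : ℂ) ^ D ≠ 0 := pow_ne_zero _ two_ne_zero
  have hs := h.sum_eq x' y'
  rw [hk] at hs
  rw [csum_layout_eq_psum]
  apply mul_left_cancel₀ h2
  rw [hs]
  ring

/-- Appending a `Z` on the last variable of line `i` multiplies the constrained path sums by the
sign `(-1)^{y'_i}`. [cite: BremnerJozsaShepherdPRSA2011, §2.4] -/
theorem csum_append_Z (L : Layout N M) (ops : List DOp) (i : Fin N) (x' y' : QReg N) :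
    csum L (fun u => phaseOf (ops ++ [DOp.Z (L.lst i)]) (uAt u)) x' y' =
      ((sgn (y' i) : ℝ) : ℂ) * csum L (fun u => phaseOf ops (uAt u)) x' y' := by
  unfold csum
  rw [Finset.mul_sum]
  refine Finset.sum_congr rfl fun u _ => ?_
  dsimp only
  by_cases hc : (∀ a, u (L.fst a) = x' a) ∧ (∀ a, u (L.lst a) = y' a)
  · rw [if_pos hc, if_pos hc, phaseOf_append, phaseOf_singleton, DOp.phase, uAt_val, hc.2 i]
    cases y' i <;> simp [sgn]
  · rw [if_neg hc, if_neg hc, mul_zero]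

/-- **Transport of the constrained path sums along a relabelling of the variables**: if the
register `Fin (N + D)` is relabelled by `e` and the operations by a map `ρ` agreeing with `e`,
the constrained sums for the transported layout are unchanged. [folklore] -/
theorem csum_map_ops {M : ℕ} (L : Layout N (N + D)) (e : Fin (N + D) ≃ Fin M) (ρ : ℕ → ℕ)
    (hρ : ∀ (v : ℕ) (h : v < N + D), ((e ⟨v, h⟩ : Fin M) : ℕ) = ρ v)
    {ops : List DOp} (hops : ∀ op ∈ ops, op.Below (N + D)) (x' y' : QReg N) :
    csum (L.map e) (fun u => phaseOf (ops.map (DOp.map ρ)) (uAt u)) x' y' =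
      csum L (fun u => phaseOf ops (uAt u)) x' y' := by
  rw [← csum_map L e]
  unfold csum
  refine Finset.sum_congr rfl fun u _ => ?_
  dsimp only
  split_ifs
  · rw [phaseOf_map]
    refine phaseOf_congr hops fun v hv => ?_
    rw [Function.comp_apply, uAt_of_lt _ hv, Function.comp_apply,
      uAt_of_lt u (by rw [← hρ v hv]; exact (e ⟨v, hv⟩).isLt)]
    congr 1
    exact Fin.ext (hρ v hv).symm
  · rfl

/-- Relabelled in-range operations are in range. [folklore] -/
theorem below_map_of_equiv {M : ℕ} (e : Fin (N + D) ≃ Fin M) (ρ : ℕ → ℕ)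
    (hρ : ∀ (v : ℕ) (h : v < N + D), ((e ⟨v, h⟩ : Fin M) : ℕ) = ρ v)
    {ops : List DOp} (hops : ∀ op ∈ ops, op.Below (N + D)) :
    ∀ op ∈ ops.map (DOp.map ρ), op.Below M := by
  intro op hop
  obtain ⟨op, hop', rfl⟩ := List.mem_map.1 hop
  refine (hops op hop').map (fun v hv => ?_) (fun v w hv hw hvw => ?_)
  · rw [← hρ v hv]; exact (e ⟨v, hv⟩).isLt
  · rw [← hρ v hv, ← hρ w hw] at hvw
    simpa using congrArg Fin.val (e.injective (Fin.ext hvw))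

/-! ### The gadget circuit of a Clifford+`T` circuit and its amplitudes -/

/-- The number of path variables allocated by the gadget rewriting of the sandwich of `C`
(`2N` for the two Hadamard layers, one per `H` gate and two per `CNOT` of `C`). [folklore] -/
def freshCount (C : QCircuit cliffordT N) : ℕ := (final (sandwich C)).k

/-- The state of the gadget rewriting of the sandwich of `C`. [folklore] -/
abbrev sfinal (C : QCircuit cliffordT N) : St N := final (sandwich C)

/-- **The gadget's operations with the polarity flip on line `i`**, relabelled along `ρ`: the
emitted `{Z, CZ, T}` operations of the sandwich of `C`, then a `Z` on the last variable of line
`i`. [cite: BremnerJozsaShepherdPRSA2011, Thm. 1 (proof) and §2.4] -/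
def gadgetOps (C : QCircuit cliffordT N) (i : Fin N) (ρ : ℕ → ℕ) : List DOp :=
  ((sfinal C).ops ++ [DOp.Z ((sfinal C).cur i)]).map (DOp.map ρ)

/-- The native layout of the gadget rewriting of the sandwich of `C`. [folklore] -/
def nativeLayout (C : QCircuit cliffordT N) : Layout N (N + freshCount C) :=
  (sfinal C).layout (final_wf _) le_rfl

/-- The operations of the gadget (with the flip) are in range before relabelling. [folklore] -/
theorem gadgetOps_below (C : QCircuit cliffordT N) (i : Fin N) :
    ∀ op ∈ (sfinal C).ops ++ [DOp.Z ((sfinal C).cur i)], op.Below (N + freshCount C) := by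
  intro op hop
  rw [List.mem_append, List.mem_singleton] at hop
  rcases hop with hop | rfl
  · exact (final_wf _).ops_below op hop
  · exact (final_wf (sandwich C)).cur_lt i

/-- **Amplitudes of the gadget's IQP circuit.** Let `C` be an oracle-free Clifford+`T` circuit
on `N` wires, `D = freshCount C`, and let the register `Fin (N + D)` of path variables be
relabelled into `Fin M` by `e` (and the operations by `ρ` agreeing with `e`). Then the IQP
circuit `H^{⊗M} D H^{⊗M}` of the relabelled gadget operations (with a `Z` on the last variable of
line `i`) satisfies, for every input label `x` and output label `y` of `C`:
`⟨y placed on the last variables| H D H |x placed on the first variables⟩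
   = 2^{-M} (√2)^D 2^N ⟨y[i ↦ ¬y_i]| U_C |x⟩`
(so its squared modulus is `2^{-D} |⟨y[i ↦ ¬y_i]|U_C|x⟩|²`, as `M = N + D`). This is BJS's
"IQP circuit with the same output conditional probabilities", in the tree's matrix semantics.
[cite: BremnerJozsaShepherdPRSA2011, Thm. 1 (proof)] -/
theorem iqpAmplitude_gadget {C : QCircuit cliffordT N} (hC : C.IsOracleFree) {M : ℕ}
    (e : Fin (N + freshCount C) ≃ Fin M) (ρ : ℕ → ℕ)
    (hρ : ∀ (v : ℕ) (h : v < N + freshCount C), ((e ⟨v, h⟩ : Fin M) : ℕ) = ρ v)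
    (i : Fin N) (x y : QReg N) :
    iqpAmplitude (realize M (gadgetOps C i ρ)) (place ((nativeLayout C).map e).fst x)
        (place ((nativeLayout C).map e).lst y) =
      ((2 : ℂ) ^ M)⁻¹ * ((Real.sqrt 2 : ℂ) ^ freshCount C *
        ((2 : ℂ) ^ N * C.toMatrix 0 (Function.update y i (!y i)) x)) := by
  have hinv : GInv (freshCount C) (gmat (sandwich C)) (sfinal C) :=
    pathSum_final _ (sandwich_isOracleFree hC) le_rfl
  have hops := gadgetOps_below C i
  have hcs : ∀ x' y' : QReg N,
      csum ((nativeLayout C).map e) (fun u => phaseOf (gadgetOps C i ρ) (uAt u)) x' y' =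
        (Real.sqrt 2 : ℂ) ^ freshCount C * ((sgn (y' i) : ℝ) : ℂ) *
          (hGateAll N * C.toMatrix 0 * hGateAll N) y' x' := by
    intro x' y'
    rw [gadgetOps, csum_map_ops _ e ρ hρ hops]
    have hZ := csum_append_Z (nativeLayout C) (sfinal C).ops i x' y'
    have hlst : (((nativeLayout C).lst i : Fin (N + freshCount C)) : ℕ) = (sfinal C).cur i := rfl
    rw [hlst] at hZ
    rw [hZ, nativeLayout, hinv.csum_eq rfl, gmat_sandwich]
    ring
  have hops' : ∀ op ∈ gadgetOps C i ρ, op.Below M := below_map_of_equiv e ρ hρ hops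
  rw [iqpAmplitude_place_eq_flip _ hops' _ _ i hcs, ← Matrix.mul_assoc, ← Matrix.mul_assoc,
    hGateAll_mul_self, Matrix.one_mul, Matrix.mul_assoc, hGateAll_mul_self, Matrix.mul_one]

end HGadget

end Literature.Computability.QuantumComplexity
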